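import Mathlib
import HarnessLib
import Literature.Analysis.FluidPDE.ParasiticSlabFlow
import Summits.NavierStokesRegularity.NavierStokesRegularity.Theorems.PoloidalWindowRigidity.Negative.CellField
import Summits.NavierStokesRegularity.NavierStokesRegularity.Theorems.PoloidalWindowRigidity.Negative.SemiEllipticColumnField

/-!
# Crux K2 `PoloidalWindowRigidity` (stmt-NavierStokesRegularity-19708) — negative side: the SEMI-ELLIPTIC THICK COLUMN,
# II: the Type-I profile, vorticity, twist bracket, class data and the window clauses

Negative-side support (refuter seat ns-regularity-refuter1, KILLSHEET K-52; D-0081 §C), continuing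
`…Negative.SemiEllipticColumnField`: `seProfile t x = (−t)^{-1/2} V(x)` with
* the directional derivatives in closed form: `∂₂v₀ = (−t)^{-1/2}(ρ(x₂) + ερ(x₀)ρ₂(x₂)) > 0`, `∂₂v₁ = 0`,
  `∂₀v₂ = (−t)^{-1/2}(ρ(x₀) − ερ₂(x₀)ρ(x₂)) > 0`, `∂₁v₂ = (−t)^{-1/2}ρ(x₁) > 0`, `∂₂v₂ = −ε(−t)^{-1/2}ρ₁(x₀)ρ₁(x₂)`, and
  **NO SHEAR SLOPE AT ANY POINT** of the open backward half-space (`seProfile_no_slope`: `∂₂v₁ = μ∂₁v₂` forces `μ = 0`,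
  then `∂₂v₀ = μ∂₀v₂ = 0` is absurd) — so the pin and the THICK clause hold on every window;
* `curl v(t) = (−t)^{-1/2}(ρ(x₁), ∂₂V₀ − ∂₀V₂, 0)` — non-zero everywhere, poloidal along `e₂`;
* the TWIST BRACKET `∂₀(∂₂v₂)·∂₁v₂ − ∂₁(∂₂v₂)·∂₀v₂ = −ε(−t)^{-1}ρ₁(x₂)ρ₂(x₀)ρ(x₁)`, positive on the window
  `seWindow = (−1,0) × {1 < x₀ < 2, 1 < x₂ < 2}` (`ρ₁(x₂) < 0 < ρ₂(x₀)` there);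
* the TYPE SCALAR `∂₂v₀·∂₀v₂ + ∂₂v₁·∂₁v₂ = (−t)^{-1}(ρ(x₂) + ερ(x₀)ρ₂(x₂))(ρ(x₀) − ερ₂(x₀)ρ(x₂)) ≥ 0` at EVERY point of
  EVERY slice (strictly positive for `t < 0`): the column is (semi-)ELLIPTIC everywhere;
* the class data (R) Type-I rate `10`, (C) continuity on the open backward slab, (D) divergence-free, (P) poloidal.
WHAT THIS IS NOT: not a claim about Navier–Stokes regularity — explicit vector calculus for a kinematic witness. [folklore]
-/

noncomputable section

-- the summit and its single sub-problem share the name (CONVENTIONS §1), as in every Theorems file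
set_option linter.dupNamespace false

namespace Summit.NavierStokesRegularity.NavierStokesRegularity.Theorems.PoloidalWindowRigidity.Negative

open MeasureTheory Set Function Filter Topology Metric
open scoped RealInnerProductSpace InnerProductSpace
open Literature.Analysis Literature.Analysis.FluidPDE

local notation "E3" => EuclideanSpace ℝ (Fin 3)
local notation "π" i => (EuclideanSpace.proj (𝕜 := ℝ) (i : Fin 3) : EuclideanSpace ℝ (Fin 3) →L[ℝ] ℝ)
local notation "𝐞" i => (EuclideanSpace.single (i : Fin 3) (1 : ℝ) : EuclideanSpace ℝ (Fin 3))

/-! ## The vorticity pattern and the derivative of `∂₂v₂` (definitions) -/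

/-- The vorticity pattern `K(x) = (ρ(x₁), ∂₂V₀ − ∂₀V₂, 0)` (`curl V = K`). [folklore] -/
def seVort (x : E3) : E3 :=
  seRho (x 1) • (𝐞 0) +
    ((seRho (x 2) + seEps * (seRho (x 0) * seRho₂ (x 2))) - (seRho (x 0) - seEps * (seRho₂ (x 0) * seRho (x 2)))) • (𝐞 1)

/-- The derivative of `x ↦ ∂₂v₂(t, x) = −ε(−t)^{-1/2}ρ₁(x₀)ρ₁(x₂)`. [folklore] -/
def seDzVzDeriv (t : ℝ) (x : E3) : E3 →L[ℝ] ℝ :=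
  cellAmp t • -(seEps • (seRho₁ (x 0) • (seRho₂ (x 2) • (π 2)) + seRho₁ (x 2) • (seRho₂ (x 0) • (π 0))))

/-! ## The profile `v(t, x) = (−t)^{-1/2} V(x)`: first derivatives and the absence of a shear slope -/

/-- `Dv(t) = (−t)^{-1/2} DV`. [folklore] -/
theorem fderiv_seProfile (t : ℝ) (x : E3) : fderiv ℝ (seProfile t) x = cellAmp t • seDeriv x :=
  ((hasFDerivAt_seField x).const_smul (cellAmp t)).fderiv

/-- `Dv(t)(x) w` in coordinates. [folklore] -/
theorem fderiv_seProfile_apply (t : ℝ) (x w : E3) (i : Fin 3) :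
    fderiv ℝ (seProfile t) x w i = cellAmp t * seDeriv x w i := by
  rw [fderiv_seProfile]; rfl

/-- `∂₂v₀ = (−t)^{-1/2}(ρ(x₂) + ερ(x₀)ρ₂(x₂))`. [folklore] -/
theorem fderiv_seProfile_e2_apply_zero (t : ℝ) (x : E3) :
    fderiv ℝ (seProfile t) x (𝐞 2) 0 = cellAmp t * (seRho (x 2) + seEps * (seRho (x 0) * seRho₂ (x 2))) := by
  rw [fderiv_seProfile_apply, seDeriv_apply_zero, show (𝐞 2) 0 = 0 by simp, show (𝐞 2) 2 = 1 by simp]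
  ring

/-- `∂₂v₁ = 0`. [folklore] -/
theorem fderiv_seProfile_e2_apply_one (t : ℝ) (x : E3) : fderiv ℝ (seProfile t) x (𝐞 2) 1 = 0 := by
  rw [fderiv_seProfile_apply, seDeriv_apply_one, mul_zero]

/-- `∂₂v₂ = −ε(−t)^{-1/2}ρ₁(x₀)ρ₁(x₂)`. [folklore] -/
theorem fderiv_seProfile_e2_apply_two (t : ℝ) (x : E3) :
    fderiv ℝ (seProfile t) x (𝐞 2) 2 = cellAmp t * (-(seEps * (seRho₁ (x 0) * seRho₁ (x 2)))) := by
  rw [fderiv_seProfile_apply, seDeriv_apply_two, show (𝐞 2) 0 = 0 by simp, show (𝐞 2) 1 = 0 by simp,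
    show (𝐞 2) 2 = 1 by simp]
  ring

/-- `∂₀v₂ = (−t)^{-1/2}(ρ(x₀) − ερ₂(x₀)ρ(x₂))`. [folklore] -/
theorem fderiv_seProfile_e0_apply_two (t : ℝ) (x : E3) :
    fderiv ℝ (seProfile t) x (𝐞 0) 2 = cellAmp t * (seRho (x 0) - seEps * (seRho₂ (x 0) * seRho (x 2))) := by
  rw [fderiv_seProfile_apply, seDeriv_apply_two, show (𝐞 0) 0 = 1 by simp, show (𝐞 0) 1 = 0 by simp,
    show (𝐞 0) 2 = 0 by simp]
  ring

/-- `∂₁v₂ = (−t)^{-1/2}ρ(x₁)`. [folklore] -/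
theorem fderiv_seProfile_e1_apply_two (t : ℝ) (x : E3) :
    fderiv ℝ (seProfile t) x (𝐞 1) 2 = cellAmp t * seRho (x 1) := by
  rw [fderiv_seProfile_apply, seDeriv_apply_two, show (𝐞 1) 0 = 0 by simp, show (𝐞 1) 1 = 1 by simp,
    show (𝐞 1) 2 = 0 by simp]
  ring

/-- `∂₂v₀ > 0` on the open backward half-space. [folklore] -/
theorem fderiv_seProfile_e2_apply_zero_pos {t : ℝ} (ht : t < 0) (x : E3) :
    0 < fderiv ℝ (seProfile t) x (𝐞 2) 0 := by
  rw [fderiv_seProfile_e2_apply_zero]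
  exact mul_pos (cellAmp_pos ht) (seDzV0_pos (x 0) (x 2))

/-- `∂₀v₂ > 0` on the open backward half-space. [folklore] -/
theorem fderiv_seProfile_e0_apply_two_pos {t : ℝ} (ht : t < 0) (x : E3) :
    0 < fderiv ℝ (seProfile t) x (𝐞 0) 2 := by
  rw [fderiv_seProfile_e0_apply_two]
  exact mul_pos (cellAmp_pos ht) (seDxV2_pos (x 0) (x 2))

/-- `∂₁v₂ > 0` on the open backward half-space. [folklore] -/
theorem fderiv_seProfile_e1_apply_two_pos {t : ℝ} (ht : t < 0) (x : E3) :
    0 < fderiv ℝ (seProfile t) x (𝐞 1) 2 := by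
  rw [fderiv_seProfile_e1_apply_two]
  exact mul_pos (cellAmp_pos ht) (seRho_pos (x 1))

/-- **NO SHEAR SLOPE AT ANY POINT.**  For `t < 0` and any `x`, no real `μ` satisfies both `∂₂v₀ = μ∂₀v₂` and
`∂₂v₁ = μ∂₁v₂`: the second forces `μ = 0` (`∂₂v₁ = 0 < ∂₁v₂`), and then the first says `∂₂v₀ = 0 < ∂₂v₀`. [folklore] -/
theorem seProfile_no_slope {t : ℝ} (ht : t < 0) (x : E3) (μ : ℝ)
    (h0 : fderiv ℝ (seProfile t) x (𝐞 2) 0 = μ * fderiv ℝ (seProfile t) x (𝐞 0) 2)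
    (h1 : fderiv ℝ (seProfile t) x (𝐞 2) 1 = μ * fderiv ℝ (seProfile t) x (𝐞 1) 2) : False := by
  have hA := fderiv_seProfile_e2_apply_zero_pos ht x
  have hB := fderiv_seProfile_e1_apply_two_pos ht x
  rw [fderiv_seProfile_e2_apply_one] at h1
  rcases mul_eq_zero.1 h1.symm with hμ | h
  · rw [hμ, zero_mul] at h0
    exact hA.ne' h0
  · exact hB.ne' h

/-! ## Vorticity -/

/-- **The vorticity of the column**: `curl v(t) = (−t)^{-1/2} K`, horizontal. [folklore] -/
theorem curl_seProfile (t : ℝ) (x : E3) : curl (seProfile t) x = cellAmp t • seVort x := by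
  ext i
  fin_cases i
  · simp [curl, seVort, fderiv_seProfile, seDeriv_apply_zero, seDeriv_apply_one, seDeriv_apply_two]
  · simp [curl, seVort, fderiv_seProfile, seDeriv_apply_zero, seDeriv_apply_one, seDeriv_apply_two]
    ring
  · simp [curl, seVort, fderiv_seProfile, seDeriv_apply_zero, seDeriv_apply_one, seDeriv_apply_two]

/-- The first component of `curl v(t)(x)`: `(−t)^{-1/2}ρ(x₁)`. [folklore] -/
theorem curl_seProfile_apply_zero (t : ℝ) (x : E3) : curl (seProfile t) x 0 = cellAmp t * seRho (x 1) := by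
  rw [curl_seProfile]; simp [seVort]

/-- The third component of `curl v(t)(x)` vanishes (poloidal along `e₂`). [folklore] -/
theorem curl_seProfile_apply_two (t : ℝ) (x : E3) : curl (seProfile t) x 2 = 0 := by
  rw [curl_seProfile]; simp [seVort]

/-- `curl v(t)(x) ≠ 0` at EVERY point of the open backward half-space. [folklore] -/
theorem curl_seProfile_ne_zero {t : ℝ} (ht : t < 0) (x : E3) : curl (seProfile t) x ≠ 0 := by
  intro h
  have h0 := curl_seProfile_apply_zero t x
  rw [h, PiLp.zero_apply] at h0
  exact (mul_pos (cellAmp_pos ht) (seRho_pos (x 1))).ne h0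

/-! ## `∂₂v₂` as a differentiable function of the point and the twist bracket -/

/-- `x ↦ ∂₂v₂(t, x)` is differentiable with derivative `seDzVzDeriv t x`. [folklore] -/
theorem hasFDerivAt_fderiv_seProfile_e2_two (t : ℝ) (x : E3) :
    HasFDerivAt (fun y : E3 => fderiv ℝ (seProfile t) y (𝐞 2) 2) (seDzVzDeriv t x) x := by
  have e : (fun y : E3 => fderiv ℝ (seProfile t) y (𝐞 2) 2) =
      fun y => cellAmp t * (-(seEps * (seRho₁ (y 0) * seRho₁ (y 2)))) :=
    funext (fderiv_seProfile_e2_apply_two t)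
  rw [e]
  have h0 : HasFDerivAt (fun y : E3 => y 0) (π 0) x := (π 0).hasFDerivAt
  have h2 : HasFDerivAt (fun y : E3 => y 2) (π 2) x := (π 2).hasFDerivAt
  have hS0 := (hasDerivAt_seRho₁ (x 0)).comp_hasFDerivAt x h0
  have hS2 := (hasDerivAt_seRho₁ (x 2)).comp_hasFDerivAt x h2
  have H := (((hS0.mul hS2).const_mul seEps).neg).const_mul (cellAmp t)
  exact H

/-- `D(∂₂v₂)(t, x) w` in coordinates. [folklore] -/
theorem seDzVzDeriv_apply (t : ℝ) (x w : E3) : seDzVzDeriv t x w =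
    cellAmp t * (-(seEps * (seRho₁ (x 0) * (seRho₂ (x 2) * w 2) + seRho₁ (x 2) * (seRho₂ (x 0) * w 0)))) := by
  rfl

/-- `∂₀(∂₂v₂) = −ε(−t)^{-1/2}ρ₁(x₂)ρ₂(x₀)`. [folklore] -/
theorem fderiv_fderiv_seProfile_e2_two_e0 (t : ℝ) (x : E3) :
    fderiv ℝ (fun y : E3 => fderiv ℝ (seProfile t) y (𝐞 2) 2) x (𝐞 0) =
      cellAmp t * (-(seEps * (seRho₁ (x 2) * seRho₂ (x 0)))) := by
  rw [(hasFDerivAt_fderiv_seProfile_e2_two t x).fderiv, seDzVzDeriv_apply, show (𝐞 0) 0 = 1 by simp,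
    show (𝐞 0) 2 = 0 by simp]
  ring

/-- `∂₁(∂₂v₂) = 0`. [folklore] -/
theorem fderiv_fderiv_seProfile_e2_two_e1 (t : ℝ) (x : E3) :
    fderiv ℝ (fun y : E3 => fderiv ℝ (seProfile t) y (𝐞 2) 2) x (𝐞 1) = 0 := by
  rw [(hasFDerivAt_fderiv_seProfile_e2_two t x).fderiv, seDzVzDeriv_apply, show (𝐞 1) 0 = 0 by simp,
    show (𝐞 1) 2 = 0 by simp]
  ring

/-- **The twist bracket** `∂₀(∂₂v₂)·∂₁v₂ − ∂₁(∂₂v₂)·∂₀v₂ = −ε(−t)^{-1}ρ₁(x₂)ρ₂(x₀)ρ(x₁)`. [folklore] -/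
theorem seProfile_twist (z : ℝ × E3) :
    fderiv ℝ (fun x => fderiv ℝ (seProfile z.1) x (𝐞 2) 2) z.2 (𝐞 0) * fderiv ℝ (seProfile z.1) z.2 (𝐞 1) 2 -
        fderiv ℝ (fun x => fderiv ℝ (seProfile z.1) x (𝐞 2) 2) z.2 (𝐞 1) * fderiv ℝ (seProfile z.1) z.2 (𝐞 0) 2 =
      -(cellAmp z.1 ^ 2 * seEps * (-seRho₁ (z.2 2) * seRho₂ (z.2 0) * seRho (z.2 1))) * (-1) := by
  rw [fderiv_fderiv_seProfile_e2_two_e0, fderiv_fderiv_seProfile_e2_two_e1, fderiv_seProfile_e1_apply_two]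
  ring

/-! ## The type scalar: (semi-)ellipticity at every point of every slice -/

/-- **The type scalar in closed form**: `∂₂v₀·∂₀v₂ + ∂₂v₁·∂₁v₂ = (−t)^{-1}(ρ(x₂) + ερ(x₀)ρ₂(x₂))(ρ(x₀) − ερ₂(x₀)ρ(x₂))`.
[folklore] -/
theorem seProfile_type (s : ℝ) (y : E3) :
    fderiv ℝ (seProfile s) y (𝐞 2) 0 * fderiv ℝ (seProfile s) y (𝐞 0) 2 +
        fderiv ℝ (seProfile s) y (𝐞 2) 1 * fderiv ℝ (seProfile s) y (𝐞 1) 2 =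
      cellAmp s ^ 2 * ((seRho (y 2) + seEps * (seRho (y 0) * seRho₂ (y 2))) *
        (seRho (y 0) - seEps * (seRho₂ (y 0) * seRho (y 2)))) := by
  rw [fderiv_seProfile_e2_apply_zero, fderiv_seProfile_e0_apply_two, fderiv_seProfile_e2_apply_one]
  ring

/-- **SEMI-ELLIPTIC AT EVERY POINT OF EVERY SLICE** (all `s : ℝ`, all `y`). [folklore] -/
theorem seProfile_type_nonneg (s : ℝ) (y : E3) :
    0 ≤ fderiv ℝ (seProfile s) y (𝐞 2) 0 * fderiv ℝ (seProfile s) y (𝐞 0) 2 +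
        fderiv ℝ (seProfile s) y (𝐞 2) 1 * fderiv ℝ (seProfile s) y (𝐞 1) 2 := by
  rw [seProfile_type]
  exact mul_nonneg (sq_nonneg _) (seType_pos (y 0) (y 2)).le

/-- **STRICTLY ELLIPTIC at every point of every backward slice** (`s < 0`). [folklore] -/
theorem seProfile_type_pos {s : ℝ} (hs : s < 0) (y : E3) :
    0 < fderiv ℝ (seProfile s) y (𝐞 2) 0 * fderiv ℝ (seProfile s) y (𝐞 0) 2 +
        fderiv ℝ (seProfile s) y (𝐞 2) 1 * fderiv ℝ (seProfile s) y (𝐞 1) 2 := by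
  rw [seProfile_type]
  exact mul_pos (pow_pos (cellAmp_pos hs) 2) (seType_pos (y 0) (y 2))

/-! ## The class hypotheses (R), (C), (D), (P) -/

/-- `‖v(t)(x)‖ ≤ 10 (−t)^{-1/2}`. [folklore] -/
theorem norm_seProfile_le (t : ℝ) (x : E3) : ‖seProfile t x‖ ≤ cellAmp t * 10 := by
  unfold seProfile
  rw [norm_smul, Real.norm_of_nonneg (cellAmp_nonneg t)]
  exact mul_le_mul_of_nonneg_left (norm_seField_le x) (cellAmp_nonneg t)

/-- (R) the Type-I time rate with constant `10`. [folklore] -/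
theorem hasTypeITimeDecay_seProfile : HasTypeITimeDecay 10 seProfile := by
  intro t _ x
  have h := norm_seProfile_le t x
  rw [cellAmp] at h
  rw [div_eq_inv_mul]
  exact h

/-- (C) continuity on the open backward slab. [folklore] -/
theorem continuousOn_seProfile : ContinuousOn (Function.uncurry seProfile) (Set.Iio (0 : ℝ) ×ˢ Set.univ) := by
  have hamp : ContinuousOn (fun z : ℝ × E3 => cellAmp z.1) (Set.Iio (0 : ℝ) ×ˢ Set.univ) := by
    refine ContinuousOn.inv₀ ?_ fun z hz => (Real.sqrt_pos.2 (neg_pos.2 (show z.1 < 0 from hz.1))).ne'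
    exact ((Real.continuous_sqrt.comp continuous_neg).comp continuous_fst).continuousOn
  exact hamp.smul (continuous_seField.comp continuous_snd).continuousOn

/-- (D) divergence-free slices: `div V = ερ₁(x₀)ρ₁(x₂) + 0 − ερ₁(x₀)ρ₁(x₂) = 0`. [folklore] -/
theorem isDivFree_seProfile (t : ℝ) : VectorCalculus.IsDivFree (seProfile t) := by
  intro y
  rw [divergence_eq_sum_inner_fderiv (EuclideanSpace.basisFun (Fin 3) ℝ), Fin.sum_univ_three]
  simp only [EuclideanSpace.basisFun_apply, EuclideanSpace.inner_single_left, map_one, one_mul,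
    fderiv_seProfile_apply, seDeriv_apply_zero, seDeriv_apply_one, seDeriv_apply_two, PiLp.single_apply]
  simp
  ring

/-- (P) poloidal along `e₂` everywhere on every slice. [folklore] -/
theorem poloidal_seProfile (s : ℝ) (y : E3) : ⟪curl (seProfile s) y, (𝐞 2)⟫_ℝ = 0 := by
  rw [EuclideanSpace.inner_single_right, curl_seProfile_apply_two]
  simp

/-! ## The window and its clauses -/

/-- The window is open. [folklore] -/
theorem isOpen_seWindow : IsOpen seWindow := by
  refine isOpen_Ioo.prod ?_
  have h0 : Continuous fun x : E3 => x 0 := by fun_prop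
  have h2 : Continuous fun x : E3 => x 2 := by fun_prop
  exact (isOpen_lt continuous_const h0).inter ((isOpen_lt h0 continuous_const).inter
    ((isOpen_lt continuous_const h2).inter (isOpen_lt h2 continuous_const)))

/-- The window is non-empty: it contains `(−1/2, (3/2, 0, 3/2))`. [folklore] -/
theorem seWindow_nonempty : seWindow.Nonempty := by
  refine ⟨((-(1 / 2) : ℝ), (3 / 2 : ℝ) • (𝐞 0) + (3 / 2 : ℝ) • (𝐞 2)), ⟨by norm_num, by norm_num⟩, ?_⟩
  have a0 : ((3 / 2 : ℝ) • (𝐞 0) + (3 / 2 : ℝ) • (𝐞 2) : E3) 0 = 3 / 2 := by simp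
  have a2 : ((3 / 2 : ℝ) • (𝐞 0) + (3 / 2 : ℝ) • (𝐞 2) : E3) 2 = 3 / 2 := by simp
  show 1 < ((3 / 2 : ℝ) • (𝐞 0) + (3 / 2 : ℝ) • (𝐞 2) : E3) 0 ∧ ((3 / 2 : ℝ) • (𝐞 0) + (3 / 2 : ℝ) • (𝐞 2) : E3) 0 < 2 ∧
    1 < ((3 / 2 : ℝ) • (𝐞 0) + (3 / 2 : ℝ) • (𝐞 2) : E3) 2 ∧ ((3 / 2 : ℝ) • (𝐞 0) + (3 / 2 : ℝ) • (𝐞 2) : E3) 2 < 2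
  rw [a0, a2]
  norm_num

/-- The window lies in the time slab `(−1, 0) × ℝ³`. [folklore] -/
theorem seWindow_subset_slab : seWindow ⊆ Set.Ioo (-1 : ℝ) 0 ×ˢ Set.univ :=
  Set.prod_mono le_rfl (Set.subset_univ _)

/-- The window lies in the open backward slab. [folklore] -/
theorem seWindow_subset : seWindow ⊆ Set.Iio (0 : ℝ) ×ˢ Set.univ :=
  Set.prod_mono Set.Ioo_subset_Iio_self (Set.subset_univ _)

/-- Membership in the window, unfolded. [folklore] -/
theorem mem_seWindow {z : ℝ × E3} (hz : z ∈ seWindow) :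
    -1 < z.1 ∧ z.1 < 0 ∧ 1 < z.2 0 ∧ z.2 0 < 2 ∧ 1 < z.2 2 ∧ z.2 2 < 2 :=
  ⟨hz.1.1, hz.1.2, hz.2.1, hz.2.2.1, hz.2.2.2.1, hz.2.2.2.2⟩

/-- **The three non-degeneracy pins hold on the window**: `curl v ≠ 0`, `∂₀v₂ ≠ 0`, `∂₂v₀ ≠ 0`. [folklore] -/
theorem seProfile_pins (z : ℝ × E3) (hz : z ∈ seWindow) :
    curl (seProfile z.1) z.2 ≠ 0 ∧
      (fderiv ℝ (seProfile z.1) z.2 (𝐞 0) 2 ≠ 0 ∨ fderiv ℝ (seProfile z.1) z.2 (𝐞 1) 2 ≠ 0) ∧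
      (fderiv ℝ (seProfile z.1) z.2 (𝐞 2) 0 ≠ 0 ∨ fderiv ℝ (seProfile z.1) z.2 (𝐞 2) 1 ≠ 0) := by
  have ht := (mem_seWindow hz).2.1
  exact ⟨curl_seProfile_ne_zero ht z.2, Or.inl (fderiv_seProfile_e0_apply_two_pos ht z.2).ne',
    Or.inl (fderiv_seProfile_e2_apply_zero_pos ht z.2).ne'⟩

/-- **The time-only slope clause holds on the window** (indeed at every point of every `W₁ ⊆ seWindow`). [folklore] -/
theorem seProfile_slope_clause_time (m : ℝ → ℝ) (W₁ : Set (ℝ × E3)) (hW₁ : W₁ ⊆ seWindow) (hne : W₁.Nonempty) :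
    ∃ z ∈ W₁, ∃ b : Fin 3, b ≠ 2 ∧
      fderiv ℝ (seProfile z.1) z.2 (𝐞 2) b ≠ m z.1 * fderiv ℝ (seProfile z.1) z.2 (𝐞 b) 2 := by
  obtain ⟨z, hz⟩ := hne
  have ht := (mem_seWindow (hW₁ hz)).2.1
  by_cases h0 : fderiv ℝ (seProfile z.1) z.2 (𝐞 2) 0 = m z.1 * fderiv ℝ (seProfile z.1) z.2 (𝐞 0) 2
  · exact ⟨z, hz, 1, by decide, fun h1 => seProfile_no_slope ht z.2 (m z.1) h0 h1⟩
  · exact ⟨z, hz, 0, by decide, h0⟩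

/-- **The THICK clause holds on the window**: for every time–height slope candidate `m : ℝ → ℝ → ℝ` and every non-empty
`W₁ ⊆ seWindow`, some (indeed every) point of `W₁` violates `∂₂v_b = m(t, x₂)∂_bv₂` for `b = 0` or `b = 1`. [folklore] -/
theorem seProfile_slope_clause_timeHeight (m : ℝ → ℝ → ℝ) (W₁ : Set (ℝ × E3)) (hW₁ : W₁ ⊆ seWindow)
    (hne : W₁.Nonempty) :
    ∃ z ∈ W₁, ∃ b : Fin 3, b ≠ 2 ∧
      fderiv ℝ (seProfile z.1) z.2 (𝐞 2) b ≠ m z.1 (z.2 2) * fderiv ℝ (seProfile z.1) z.2 (𝐞 b) 2 := by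
  obtain ⟨z, hz⟩ := hne
  have ht := (mem_seWindow (hW₁ hz)).2.1
  by_cases h0 : fderiv ℝ (seProfile z.1) z.2 (𝐞 2) 0 = m z.1 (z.2 2) * fderiv ℝ (seProfile z.1) z.2 (𝐞 0) 2
  · exact ⟨z, hz, 1, by decide, fun h1 => seProfile_no_slope ht z.2 (m z.1 (z.2 2)) h0 h1⟩
  · exact ⟨z, hz, 0, by decide, h0⟩

/-- **The twist bracket is non-zero on the window** (`= ε(−t)^{-1}(−ρ₁(x₂))ρ₂(x₀)ρ(x₁) > 0`). [folklore] -/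
theorem seProfile_twist_ne_zero (z : ℝ × E3) (hz : z ∈ seWindow) :
    fderiv ℝ (fun x => fderiv ℝ (seProfile z.1) x (𝐞 2) 2) z.2 (𝐞 0) * fderiv ℝ (seProfile z.1) z.2 (𝐞 1) 2 -
        fderiv ℝ (fun x => fderiv ℝ (seProfile z.1) x (𝐞 2) 2) z.2 (𝐞 1) * fderiv ℝ (seProfile z.1) z.2 (𝐞 0) 2 ≠ 0 := by
  rw [seProfile_twist]
  obtain ⟨-, ht, hx0, -, hx2, -⟩ := mem_seWindow hz
  have hpos : 0 < cellAmp z.1 ^ 2 * seEps * (-seRho₁ (z.2 2) * seRho₂ (z.2 0) * seRho (z.2 1)) := by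
    have hε : (0 : ℝ) < seEps := by rw [seEps]; norm_num
    have h1 : 0 < -seRho₁ (z.2 2) := neg_pos.2 (seRho₁_neg (by linarith))
    exact mul_pos (mul_pos (pow_pos (cellAmp_pos ht) 2) hε)
      (mul_pos (mul_pos h1 (seRho₂_pos hx0)) (seRho_pos _))
  nlinarith

end Summit.NavierStokesRegularity.NavierStokesRegularity.Theorems.PoloidalWindowRigidity.Negative

end
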